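import Mathlib
import Summits.ResolutionOfSingularities.ResolutionOfSingularities.Theorems.CleanModels.Negative.CossartPiltant2019Thm15iFrameOrdTowerPointBlowup
import HarnessLib

/-!
# F-110 is FALSE modulo the curve blow-up facts along `ord_𝔪` — the tower induction done

Third negative lemma (INPUTS seat res-inputs-p-cp15frame g1, 2026-08-28) on the RETIRED statement F-110
`Literature.AlgebraicGeometry.CossartPiltant200819.CossartPiltant2019_thm_1_5_i_frame` (crux `CleanModels`,
stmt-ResolutionOfSingularities-15917).  It runs res-inputs-crit-1 R190 (3)'s INDUCTION OVER THE TOWER in Lean and thereby shrinks the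
residual hypothesis `OrdTowerShape 5` of `CossartPiltant2019_thm_1_5_i_frame_false_of_ordTowerShape` to the facts about ONE kind of
ring, the curve blow-ups `B♯`:

* `OrdWitness.IsCurveBlowup B'` — `B'` is the local blowing up, with respect to `O = ord_𝔪`, of the first member `range (S → K)` along
  a centre `P` with regular quotient which is neither the closed point (`P` misses a non-unit) nor principal;
* `OrdWitness.Kind B := B = range (S → K) ∨ B = O ∨ IsCurveBlowup B` — the THREE KINDS of R190 (3);
* `CurveBlowupFacts p` (`H‴`, `--negative-modulo`): for every curve blow-up `B♯` which is a regular local ring: (a) its regular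
  parameters have order `1`, (b) its residues that are `p`-th powers in `κ(O)` are `p`-th powers in `κ(B♯)`, (c) every local blowing up
  of `B♯` along a centre with regular quotient is `B♯` itself or `O` (on paper: `dim B♯ = 2`, height-one primes principal, and the blow-up
  of the closed point of `B♯` is `O` because `(t₃/u₀)‾` is transcendental over `κ(B♯) = 𝔽₅(τ)`);
* PROVED: `OrdWitness.kind_step` — one `IsLocalBlowupAlong` step preserves `Kind` (kind `S`: principal centre ⇒ `S` by
  `eq_of_isLocalBlowupAlong_of_span_singleton`, closed point ⇒ `O` by `eq_valuationSubring_of_isLocalBlowupAlong_maximalIdeal`, else a curve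
  blow-up by definition; kind `O` ⇒ `O`; kind `B♯` ⇒ (c)); `OrdWitness.kind_of_tower` — every member of every F-110 tower has a kind;
  `ordTowerShape_of_curveBlowupFacts : CurveBlowupFacts p → OrdTowerShape p` (kinds `S`, `O` by the landed shape facts, kind `B♯` by
  (a), (b)); and the headline
  **`CossartPiltant2019_thm_1_5_i_frame_false_of_curveBlowupFacts : @CurveBlowupFacts 5 ⟨Nat.prime_five⟩ → ¬ CossartPiltant2019_thm_1_5_i_frame.{0}`**.

What remains for an unconditional `¬ F-110`: `theorem curveBlowupFacts_five : CurveBlowupFacts 5` — the analysis of the rings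
`B♯ = S[v/u₀]_{𝔪_S S[v/u₀]}` (tree machinery: `BlowupChartRsop.lean`, `RegularCentreRsopPart.lean`, `HeightOnePrimes.lean`).
Nothing here proves or refutes resolution of singularities in characteristic `p`; [OURS · NEGATIVE] counted 0.
-/

noncomputable section

set_option linter.dupNamespace false -- mandated namespace of this single-conjunct summit

open MvPolynomial IsLocalRing
open Literature.AlgebraicGeometry.Resolution Literature.AlgebraicGeometry.Resolution.WeightedBlowup

namespace Summit.ResolutionOfSingularities.ResolutionOfSingularities.Theorems.CleanModels.Negative

namespace OrdWitness

variable (p : ℕ) [hp : Fact p.Prime]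

/-! ## 1. The three kinds -/

/-- **A curve blow-up `B♯`**: the local blowing up, with respect to `O`, of the first member `range (S → K)` along a centre `P`
with regular quotient, `P` missing some non-unit (not the closed point) and not principal. [folklore] -/
def IsCurveBlowup (B' : Subring (K p)) : Prop :=
  ∃ P : Ideal (algebraMap (S p) (K p)).range,
    IsRegularLocalRing ((algebraMap (S p) (K p)).range ⧸ P) ∧
    (∃ x : (algebraMap (S p) (K p)).range, ¬ IsUnit x ∧ x ∉ P) ∧
    (∀ π : (algebraMap (S p) (K p)).range, P ≠ Ideal.span {π}) ∧
    IsLocalBlowupAlong (O p) (algebraMap (S p) (K p)).range P B'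

/-- **The three kinds of tower members** (res-inputs-crit-1 R190 (3)): `S` itself, `O`, or a curve blow-up. [folklore] -/
def Kind (B : Subring (K p)) : Prop :=
  B = (algebraMap (S p) (K p)).range ∨ B = (O p).toSubring ∨ IsCurveBlowup p B

end OrdWitness

/-- **`H‴ = CurveBlowupFacts p`** (hypothesis of this negative lemma; NOT a published statement — the `B♯`-analysis of
res-inputs-crit-1 R190 (3)): for every curve blow-up `B♯` along `ord_𝔪` on `𝔽_p[X₀,X₁,X₂]_{(X)}` which is a regular local ring,
(a) every `t ∈ 𝔪 ∖ 𝔪²` has `ordVK t = exp (−1)`; (b) for `u ∈ B♯`, `d ∈ O` with `ord (u − d^p) > 0` there is `e ∈ B♯` with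
`ord (u − e^p) > 0`; (c) every local blowing up of `B♯` along a centre with regular quotient is `B♯` or `O`. -/
def CurveBlowupFacts (p : ℕ) [Fact p.Prime] : Prop :=
  ∀ B : Subring (OrdWitness.K p), OrdWitness.IsCurveBlowup p B → ∀ (_ : IsRegularLocalRing B),
    (∀ t : B, t ∈ IsLocalRing.maximalIdeal B → t ∉ IsLocalRing.maximalIdeal B ^ 2 →
      OrdWitness.ordVK p (t : OrdWitness.K p) = OrdWitness.expNeg 1) ∧
    (∀ (u : B) (d : OrdWitness.K p), d ∈ OrdWitness.O p →
      OrdWitness.ordVK p ((u : OrdWitness.K p) - d ^ p) < 1 →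
      ∃ e : B, OrdWitness.ordVK p ((u : OrdWitness.K p) - (e : OrdWitness.K p) ^ p) < 1) ∧
    (∀ (P : Ideal B) (B' : Subring (OrdWitness.K p)), IsRegularLocalRing (B ⧸ P) →
      IsLocalBlowupAlong (OrdWitness.O p) B P B' → B' = B ∨ B' = (OrdWitness.O p).toSubring)

namespace OrdWitness

variable (p : ℕ) [hp : Fact p.Prime]

/-! ## 2. One step of the tower preserves the kind -/

/-- **Kind is preserved by a local blowing up along a centre with regular quotient** (given `H‴` for the curve blow-ups).
From `S`: the closed point gives `O` (roadmap T3), a principal centre gives `S` back (T1), anything else is a curve blow-up;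
from `O`: `O`; from a curve blow-up: `H‴` (c). [folklore] -/
theorem kind_step (hIII : CurveBlowupFacts p) (B B' : Subring (K p)) (hk : Kind p B) [IsRegularLocalRing B]
    (P : Ideal B) (hreg : IsRegularLocalRing (B ⧸ P)) (H : IsLocalBlowupAlong (O p) B P B') : Kind p B' := by
  rcases hk with hS | hO | hC
  · -- kind `S`
    by_cases hmax : P = maximalIdeal B
    · exact Or.inr (Or.inl (eq_valuationSubring_of_isLocalBlowupAlong_maximalIdeal p B B' hS hmax H))
    by_cases hprin : ∃ π : B, P = Ideal.span {π}
    · obtain ⟨π, hπ⟩ := hprin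
      have hfix : locAtCentre B (O p) = B := by rw [hS]; exact locAtCentre_range_eq p
      exact Or.inl ((eq_of_isLocalBlowupAlong_of_span_singleton hfix hπ H).trans hS)
    · -- a curve blow-up
      subst hS
      refine Or.inr (Or.inr ⟨P, hreg, ?_, fun π hπ => hprin ⟨π, hπ⟩, H⟩)
      have hPtop : P ≠ ⊤ := by
        intro h
        haveI := hreg
        haveI : Subsingleton ((algebraMap (S p) (K p)).range ⧸ P) := Ideal.Quotient.subsingleton_iff.mpr h
        exact false_of_nontrivial_of_subsingleton ((algebraMap (S p) (K p)).range ⧸ P)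
      have hle : P ≤ maximalIdeal _ := IsLocalRing.le_maximalIdeal hPtop
      have hne : ¬ maximalIdeal _ ≤ P := fun h => hmax (le_antisymm hle h)
      obtain ⟨x, hx, hxP⟩ := SetLike.not_le_iff_exists.mp hne
      exact ⟨x, (IsLocalRing.mem_maximalIdeal _).mp hx, hxP⟩
  · -- kind `O`
    subst hO
    exact Or.inr (Or.inl (eq_of_isLocalBlowupAlong_valuationSubring H))
  · -- a curve blow-up
    rcases (hIII B hC inferInstance).2.2 P B' hreg H with h | h
    · rw [h]; exact Or.inr (Or.inr hC)
    · exact Or.inr (Or.inl h)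

/-- **Every member of an F-110 tower along `ord_𝔪` has a kind** (induction over the tower, given `H‴`). [folklore] -/
theorem kind_of_tower (hIII : CurveBlowupFacts p) (n : ℕ) (B : ℕ → Subring (K p))
    (hB0 : B 0 = locAtCentre (algebraMap (S p) (K p)).range (O p))
    (hB : ∀ i ≤ n, B i ≤ (O p).toSubring ∧ IsRegularLocalRing (B i))
    (hstep : ∀ i < n, ∃ P : Ideal (B i), IsRegularLocalRing ((B i) ⧸ P) ∧ IsLocalBlowupAlong (O p) (B i) P (B (i + 1))) :
    ∀ i ≤ n, Kind p (B i) := by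
  intro i hi
  induction i with
  | zero =>
    left
    rw [hB0]
    exact locAtCentre_range_eq p
  | succ j ih =>
    have hkj := ih (by omega)
    obtain ⟨P, hreg, H⟩ := hstep j (by omega)
    haveI := (hB j (by omega)).2
    exact kind_step p hIII (B j) (B (j + 1)) hkj P hreg H

end OrdWitness

/-! ## 3. `H‴ ⟹ H″`, and the negative lemma -/

/-- **Curve blow-up facts ⟹ tower shape**: `CurveBlowupFacts p → OrdTowerShape p`.  The last member has a kind
(`kind_of_tower`); kind `S`: `ordVK_eq_expNeg_one_of_kindS`, `exists_pow_of_kindS`; kind `O`: `ordVK_eq_expNeg_one_of_kindO`,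
`exists_pow_of_kindO`; kind `B♯`: `H‴` (a), (b). [folklore] -/
theorem ordTowerShape_of_curveBlowupFacts (p : ℕ) [Fact p.Prime] (hIII : CurveBlowupFacts p) : OrdTowerShape p := by
  intro n B hB0 hB hstep hregn
  have hk := OrdWitness.kind_of_tower p hIII n B hB0 hB hstep n le_rfl
  rcases hk with hS | hO | hC
  · exact ⟨fun t ht ht2 => OrdWitness.ordVK_eq_expNeg_one_of_kindS p (B n) hS t ht ht2,
      fun u d hd h => OrdWitness.exists_pow_of_kindS p (B n) hS u d hd h⟩
  · exact ⟨fun t ht ht2 => OrdWitness.ordVK_eq_expNeg_one_of_kindO p (B n) hO t ht ht2,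
      fun u d hd h => OrdWitness.exists_pow_of_kindO p (B n) hO u d hd h⟩
  · obtain ⟨ha, hb, -⟩ := hIII (B n) hC hregn
    exact ⟨ha, hb⟩

/-- **F-110 is false modulo `H‴ = CurveBlowupFacts 5`** — the honest residual of res-inputs-crit-1 R190 (3) is now the
analysis of the curve blow-ups `B♯ = S[v/u₀]_{𝔪_S S[v/u₀]}` along `ord_𝔪` alone (regular parameters of order `1`; residue
field relatively `5`-closed in `κ(O)`; blow-ups of `B♯` are `B♯` or `O`); the witness base, the three-kind induction over towers, the
kinds `S` and `O`, the `K⁵`-line bookkeeping and the regularity criterion for `B[X]/(X⁵ − g)` are all kernel-checked. [folklore] -/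
theorem CossartPiltant2019_thm_1_5_i_frame_false_of_curveBlowupFacts (h : @CurveBlowupFacts 5 ⟨Nat.prime_five⟩) :
    ¬ Literature.AlgebraicGeometry.CossartPiltant200819.CossartPiltant2019_thm_1_5_i_frame.{0} :=
  CossartPiltant2019_thm_1_5_i_frame_false_of_ordTowerShape
    (@ordTowerShape_of_curveBlowupFacts 5 ⟨Nat.prime_five⟩ h)

end Summit.ResolutionOfSingularities.ResolutionOfSingularities.Theorems.CleanModels.Negative

end
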